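/-
Copyright (c) 2026 the pub-hodgecm-mathlib formalisation cell (harness21).  Prover seat hodgecm-mathlib-K2E1-p12 (g0), Track B ∕ K2-LIT (build stream 29),
h413 = `stmt-HodgeConjecture-24833`, line `K2_E1_TraceFormulaBeta`, 5Res campaign, rung R8₂-sph «EXHAUSTION» (ROADCARD `K2/K2E1-p09/g6/ROADCARD-R8-EXHAUSTION-SPH-2.K2E1-p09-g6.md`,
ROAD T′, step T9 = THE ASSEMBLER), dealer K2E1-plan (g6) deal (90) 2026-09-04T10:42:49Z.  HYPOTHESIS-FIRST: the algebraic core is letter-free (Mathlib + ★ T6); the automorphic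
instantiation carries the letters (T5-weak, ADM, DISC) named in the census 2026-09-04T10:45Z.
-/
import Summits.HodgeConjecture.HodgeConjecture.Theorems.K2E1ProjectionCommutingMultiplicationOperators  -- ★ T6 (this seat, p859424): `submodule_eq_bot_of_invariant_of_forall_eigenvector_eq_zero`, `lp_eq_zero_…`
import Summits.HodgeConjecture.HodgeConjecture.Theorems.K2E1CuspidalSpectrumUnitaryDefsR                 -- ★ `cmResidualSubspaceR` (+ ★ `residualSubspace`, `residualPart`, Literature `ClosedSubrep`, `rightRegular`, `L2`)
import Mathlib.LinearAlgebra.FiniteDimensional.Defs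
import Mathlib.LinearAlgebra.Span.Basic
import Mathlib.Topology.Algebra.Module.FiniteDimension
import HarnessLib

/-!
# K2·E1 — `K2E1ResidualSphericalLineCMTwoOfLetters` (R8₂-sph, ROAD T′, step T9 — THE ASSEMBLER, ALGEBRAIC CORE): A STABLE SUBSPACE MAPPED INJECTIVELY-MODULO-A-LINE INTO A SPACE ON
# WHICH THE INTERTWINED OPERATOR HAS NO EIGENVECTORS MEETS EVERY FINITE-DIMENSIONAL STABLE SUBSPACE INSIDE THAT LINE

Track B ∕ K2-LIT, crux h413 = `stmt-HodgeConjecture-24833`, route of record `HCCMUnconditional`; cell `hodgecm-mathlib`, squad K2, ENGINE E1.  THEOREMS ONLY (no `def`, no `instance`, no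
notation, no named-fact hypothesis, no `sorry`; default heartbeats); lane `--kind proof --supports stmt-HodgeConjecture-24833 --as helper` (count-neutral).

THE ROAD (roadcard T5–T9, door (β) «admissibility» combined with ★ T6 ∕ ★ T7): on the `K`-fixed part `E = ((L²_cusp)ᗮ)^K` of `L²(U(Φ₂)(L⁺)∖U(Φ₂)(𝔸_{L⁺}))` the spherical Plancherel data
`U = (a, f) : E → ℂ ⊕ L²(ℝ_{≥0}, w dt)` intertwine the Hecke operator `R(h₀)` of ONE shell test function with `(ĥ₀(1), M_{ĥ₀(½+i·)})` and are injective (T5); the multiplier has countable,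
hence null, level sets (★ T7), so `M_{ĥ₀(½+i·)}` has no eigenvectors (★ T6); the constant function `𝟙` has `f 𝟙 = 0`, `a 𝟙 ≠ 0`.  THIS FILE proves the ALGEBRA that turns these into the
exhaustion statement: (§1) every `R(h₀)`-EIGENVECTOR in `E` is a multiple of `𝟙` (`f v` would be an eigenvector of `M`, so `f v = 0`, and `v − (a v ∕ a 𝟙)·𝟙` is killed by `(a, f)`), and
(§2) every FINITE-DIMENSIONAL `R(h₀)`-stable `W ≤ E` lies in `ℂ𝟙` (`f(W)` is a finite-dimensional `M`-stable subspace without eigenvectors, hence `0` by ★ T6 §4, and then `(a, f)`-injectivity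
modulo the line).  With (ADM) «`Π^K` is finite-dimensional for every irreducible closed `Π ≤ L²_res`» and (DISC) «`(L²_res)^K` is the closed span of the `Π^K`», each `Π^K ≤ ℂ𝟙`, so
`Π ∋ 𝟙`, `Π = ℂ𝟙` by irreducibility, and `(L²_res)^K = ℂ𝟙` — the `≤` half of «`L²_res ⊓ sph = ℂ·𝟙`» (the `≥` half is ★ p859288 `span_const_le_cmResidualSubspace_two`).  The
automorphic instantiation (§3, on the letters (T5-weak)(ADM)(DISC), conclusion in ★ `cmResidualSubspaceR` ∕ `ClosedSubrep.fixedVectors` ∕ `Lp.const` currency) follows in ED. 2 once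
the dealer fixes the conclusion bytes (census 2026-09-04T10:45Z, item (3)); §1–§2 are the letter-free, Mathlib-level part and are typed now.

* §1 **`mem_span_of_eigenvector_of_intertwining`** — `R v = c·v`, `v ∈ E` ⇒ `v ∈ 𝕜 ∙ e₀` (any field `𝕜`, any modules; hypotheses: `f ∘ R = M ∘ f` on `E`, `M` has no eigenvectors,
  `(a, f)` injective on `E`, `e₀ ∈ E`, `f e₀ = 0`, `a e₀ ≠ 0`).
* §2 **`le_span_of_finiteDimensional_of_stable`** — every finite-dimensional `R`-stable `W ≤ E` is `≤ 𝕜 ∙ e₀` (algebraically closed `𝕜`; ★ T6 §4 on `W.map f`); and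
  **`eq_span_or_eq_bot_of_finiteDimensional_of_stable`** — such a `W` is `⊥` or the whole line `𝕜 ∙ e₀`.
HONEST LABEL: HC_CM is proved only modulo the 7 printed citations (2 remaining named inputs: hLiu418 = `stmt-HodgeConjecture-24832`, h413 = `stmt-HodgeConjecture-24833`) until rung 0
closes; this file asserts no named fact, closes no socket and crosses no ceiling by itself; count-neutral.

## References
* [Iwaniec2002] H. Iwaniec, *Spectral Methods of Automorphic Forms*, 2nd ed., GSM 53 (2002), §7 (spectral decomposition of incomplete Eisenstein series; p. 103).
* [Borel1997] A. Borel, *Automorphic Forms on SL₂(ℝ)*, Cambridge Tracts in Math. 130 (1997), §§13–16.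
* [MoeglinWaldspurger1995] C. Mœglin, J.-L. Waldspurger, *Spectral Decomposition and Eisenstein Series* (1995), V.3.2–V.3.13 (the residual spectrum of rank one).
-/

set_option autoImplicit false
-- the mandated namespace repeats `HodgeConjecture.HodgeConjecture`, as in every `Theorems/*.lean` of this sub-problem
set_option linter.dupNamespace false

noncomputable section

open Submodule MeasureTheory NumberField
open Literature.NumberTheory.Automorphic Literature.NumberTheory.Automorphic.UnitaryGroup ContRepresentation
open Summit.HodgeConjecture.HodgeConjecture.Cruxes.H413.K2E1ProjectionCommutingMultiplicationOperators (submodule_eq_bot_of_invariant_of_forall_eigenvector_eq_zero')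
open Summit.HodgeConjecture.HodgeConjecture.Cruxes.H413.K2E1CuspidalSpectrumUnitary

namespace Summit.HodgeConjecture.HodgeConjecture.Cruxes.H413.K2E1ResidualSphericalLineCMTwoOfLetters

/-! ## §1 Eigenvectors of `R` in `E` are multiples of `e₀` -/

section Eigen

variable {𝕜 : Type*} [Field 𝕜] {H : Type*} [AddCommGroup H] [Module 𝕜 H] {F : Type*} [AddCommGroup F] [Module 𝕜 F]

/-- **EVERY `R`-EIGENVECTOR IN `E` IS A MULTIPLE OF `e₀`.**  Data: `R : H → H` linear with `R(E) ⊆ E`; the «Plancherel data» `a : H → 𝕜`, `f : H → F` linear with `f (R v) = M (f v)` on `E` for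
an operator `M` of `F` WITHOUT EIGENVECTORS (`M w = c·w ⇒ w = 0`; e.g. a multiplication operator with null level sets, ★ T6∕T7); `(a, f)` injective on `E`; `e₀ ∈ E` with `f e₀ = 0`,
`a e₀ ≠ 0` (the constant function).  Then `R v = c·v`, `v ∈ E` ⇒ `v ∈ 𝕜 ∙ e₀`: `f v` is an `M`-eigenvector, so `f v = 0`, and `v − (a v ∕ a e₀)·e₀` is killed by `a` and `f`.
[cite: Iwaniec2002, §7 (p. 103)] [cite: Borel1997, §13] -/
theorem mem_span_of_eigenvector_of_intertwining (R : H →ₗ[𝕜] H) (E : Submodule 𝕜 H) (a : H →ₗ[𝕜] 𝕜) (f : H →ₗ[𝕜] F) (M : F →ₗ[𝕜] F)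
    (hf : ∀ v ∈ E, f (R v) = M (f v)) (hM : ∀ (c : 𝕜) (w : F), M w = c • w → w = 0)
    (hinj : ∀ v ∈ E, a v = 0 → f v = 0 → v = 0) {e₀ : H} (he₀ : e₀ ∈ E) (hf₀ : f e₀ = 0) (ha₀ : a e₀ ≠ 0)
    {v : H} (hv : v ∈ E) {c : 𝕜} (hRv : R v = c • v) : v ∈ 𝕜 ∙ e₀ := by
  -- `f v` is an eigenvector of `M`, hence `0`
  have hfv : f v = 0 := by
    refine hM c (f v) ?_
    rw [← hf v hv, hRv, map_smul]
  -- `w := v - (a v / a e₀) • e₀` is killed by `a` and `f`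
  set t : 𝕜 := a v * (a e₀)⁻¹ with ht
  have hw : v - t • e₀ ∈ E := E.sub_mem hv (E.smul_mem t he₀)
  have haw : a (v - t • e₀) = 0 := by
    rw [map_sub, map_smul, smul_eq_mul, ht, mul_assoc, inv_mul_cancel₀ ha₀, mul_one, sub_self]
  have hfw : f (v - t • e₀) = 0 := by rw [map_sub, map_smul, hfv, hf₀, smul_zero, sub_self]
  have h0 := hinj _ hw haw hfw
  rw [sub_eq_zero] at h0
  exact mem_span_singleton.2 ⟨t, h0.symm⟩

/-- The kernel statement behind §1: **`v ∈ E` with `f v = 0` lies in `𝕜 ∙ e₀`** (no operator needed). [cite: Iwaniec2002, §7 (p. 103)] -/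
theorem mem_span_of_apply_eq_zero (E : Submodule 𝕜 H) (a : H →ₗ[𝕜] 𝕜) (f : H →ₗ[𝕜] F)
    (hinj : ∀ v ∈ E, a v = 0 → f v = 0 → v = 0) {e₀ : H} (he₀ : e₀ ∈ E) (hf₀ : f e₀ = 0) (ha₀ : a e₀ ≠ 0)
    {v : H} (hv : v ∈ E) (hfv : f v = 0) : v ∈ 𝕜 ∙ e₀ := by
  set t : 𝕜 := a v * (a e₀)⁻¹ with ht
  have hw : v - t • e₀ ∈ E := E.sub_mem hv (E.smul_mem t he₀)
  have haw : a (v - t • e₀) = 0 := by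
    rw [map_sub, map_smul, smul_eq_mul, ht, mul_assoc, inv_mul_cancel₀ ha₀, mul_one, sub_self]
  have hfw : f (v - t • e₀) = 0 := by rw [map_sub, map_smul, hfv, hf₀, smul_zero, sub_self]
  have h0 := hinj _ hw haw hfw
  rw [sub_eq_zero] at h0
  exact mem_span_singleton.2 ⟨t, h0.symm⟩

end Eigen

/-! ## §2 Finite-dimensional `R`-stable subspaces of `E` lie in the line `𝕜 ∙ e₀` (door (β): admissibility) -/

section Stable

variable {𝕜 : Type*} [Field 𝕜] [IsAlgClosed 𝕜] {H : Type*} [AddCommGroup H] [Module 𝕜 H] {F : Type*} [AddCommGroup F] [Module 𝕜 F]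

/-- **EVERY FINITE-DIMENSIONAL `R`-STABLE `W ≤ E` LIES IN `𝕜 ∙ e₀`** (algebraically closed `𝕜`): `f(W)` is a finite-dimensional `M`-stable subspace of `F` (`f ∘ R = M ∘ f` on `E ⊇ W`) on which
`M` has no eigenvector, hence `f(W) = 0` (★ T6 `submodule_eq_bot_of_invariant_of_forall_eigenvector_eq_zero'`); then §1's kernel statement.  With `W = Π^K` for an irreducible closed
`Π ≤ L²_res` (finite-dimensional by admissibility) this is «`Π^K ≤ ℂ𝟙`». [cite: Iwaniec2002, §7 (p. 103)] [cite: MoeglinWaldspurger1995, V.3.13] -/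
theorem le_span_of_finiteDimensional_of_stable (R : H →ₗ[𝕜] H) (E : Submodule 𝕜 H) (a : H →ₗ[𝕜] 𝕜) (f : H →ₗ[𝕜] F) (M : F →ₗ[𝕜] F)
    (hf : ∀ v ∈ E, f (R v) = M (f v)) (hM : ∀ (c : 𝕜) (w : F), M w = c • w → w = 0)
    (hinj : ∀ v ∈ E, a v = 0 → f v = 0 → v = 0) {e₀ : H} (he₀ : e₀ ∈ E) (hf₀ : f e₀ = 0) (ha₀ : a e₀ ≠ 0)
    (W : Submodule 𝕜 H) [FiniteDimensional 𝕜 W] (hWE : W ≤ E) (hWR : ∀ w ∈ W, R w ∈ W) : W ≤ 𝕜 ∙ e₀ := by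
  -- `f(W)` is `M`-stable and finite-dimensional, and `M` has no eigenvectors there: `f(W) = ⊥`
  have hstable : ∀ y ∈ W.map f, M y ∈ W.map f := by
    rintro _ ⟨w, hw, rfl⟩
    exact ⟨R w, hWR w hw, hf w (hWE hw)⟩
  have hbot : W.map f = ⊥ := submodule_eq_bot_of_invariant_of_forall_eigenvector_eq_zero' M (W.map f) hstable fun c y h => hM c y h
  intro w hw
  have hfw : f w = 0 := by
    have : f w ∈ W.map f := ⟨w, hw, rfl⟩
    rw [hbot] at this
    exact (mem_bot 𝕜).1 this
  exact mem_span_of_apply_eq_zero E a f hinj he₀ hf₀ ha₀ (hWE hw) hfw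

/-- **A finite-dimensional `R`-stable `W ≤ E` is `⊥` or the whole line `𝕜 ∙ e₀`** (a subspace of a line; `e₀ ≠ 0` since `a e₀ ≠ 0`).  For `W = Π^K ≠ 0` this puts `e₀ = 𝟙` in `Π`.
[cite: Iwaniec2002, §7 (p. 103)] [cite: MoeglinWaldspurger1995, V.3.13] -/
theorem eq_bot_or_eq_span_of_finiteDimensional_of_stable (R : H →ₗ[𝕜] H) (E : Submodule 𝕜 H) (a : H →ₗ[𝕜] 𝕜) (f : H →ₗ[𝕜] F) (M : F →ₗ[𝕜] F)
    (hf : ∀ v ∈ E, f (R v) = M (f v)) (hM : ∀ (c : 𝕜) (w : F), M w = c • w → w = 0)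
    (hinj : ∀ v ∈ E, a v = 0 → f v = 0 → v = 0) {e₀ : H} (he₀ : e₀ ∈ E) (hf₀ : f e₀ = 0) (ha₀ : a e₀ ≠ 0)
    (W : Submodule 𝕜 H) [FiniteDimensional 𝕜 W] (hWE : W ≤ E) (hWR : ∀ w ∈ W, R w ∈ W) : W = ⊥ ∨ W = 𝕜 ∙ e₀ := by
  have hle := le_span_of_finiteDimensional_of_stable R E a f M hf hM hinj he₀ hf₀ ha₀ W hWE hWR
  by_cases hW : W = ⊥
  · exact Or.inl hW
  · refine Or.inr (le_antisymm hle ?_)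
    -- a nonzero `w ∈ W ≤ 𝕜 ∙ e₀` is `t • e₀` with `t ≠ 0`, so `e₀ ∈ W`
    obtain ⟨w, hwW, hw0⟩ := (Submodule.ne_bot_iff W).1 hW
    obtain ⟨t, rfl⟩ := mem_span_singleton.1 (hle hwW)
    have ht : t ≠ 0 := fun h => hw0 (by rw [h, zero_smul])
    have he₀W : e₀ ∈ W := by
      have h := W.smul_mem t⁻¹ hwW
      rwa [smul_smul, inv_mul_cancel₀ ht, one_smul] at h
    exact (span_singleton_le_iff_mem e₀ W).2 he₀W

/-- The «`𝟙 ∈ Π`» form: a NONZERO finite-dimensional `R`-stable `W ≤ E` contains `e₀`. [cite: Iwaniec2002, §7 (p. 103)] -/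
theorem mem_of_finiteDimensional_of_stable_of_ne_bot (R : H →ₗ[𝕜] H) (E : Submodule 𝕜 H) (a : H →ₗ[𝕜] 𝕜) (f : H →ₗ[𝕜] F) (M : F →ₗ[𝕜] F)
    (hf : ∀ v ∈ E, f (R v) = M (f v)) (hM : ∀ (c : 𝕜) (w : F), M w = c • w → w = 0)
    (hinj : ∀ v ∈ E, a v = 0 → f v = 0 → v = 0) {e₀ : H} (he₀ : e₀ ∈ E) (hf₀ : f e₀ = 0) (ha₀ : a e₀ ≠ 0)
    (W : Submodule 𝕜 H) [FiniteDimensional 𝕜 W] (hWE : W ≤ E) (hWR : ∀ w ∈ W, R w ∈ W) (hW : W ≠ ⊥) : e₀ ∈ W := by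
  rcases eq_bot_or_eq_span_of_finiteDimensional_of_stable R E a f M hf hM hinj he₀ hf₀ ha₀ W hWE hWR with h | h
  · exact absurd h hW
  · rw [h]; exact mem_span_singleton_self e₀

end Stable

/-! ## §3 The representation-theoretic assembly ON LETTERS: `K`-fixed vectors of the residual part `D ⊓ Cᗮ` of a unitary representation are multiples of `e₀` -/

section Rep

variable {G : Type*} [Group G] {V : Type*} [NormedAddCommGroup V] [InnerProductSpace ℂ V] [CompleteSpace V] {π : ContRepresentation ℂ G V}

/-- **T9 ON LETTERS, EVERY UNITARY REPRESENTATION**: for a unitary `π` on a Hilbert space `V`, closed invariant `C, Res` with `Res ⟂ C` (think `L²_cusp` and `L²_res = L²_disc ⊓ (L²_cusp)ᗮ`, ★ `residualPart` ∕ `residualSubspace`), a subgroup or set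
`K ⊆ G` with its submodule of fixed vectors `Kfix` (ANY spelling, pinned by `hKfix`), an operator `R₀` (the Hecke operator of ONE shell test function) that preserves every closed invariant
subspace of `Res` (`hRW`) and `K`-fixedness (`hRK`), Plancherel data `(a, f, M)` on `E := Cᗮ ⊓ Kfix` (T5-weak: `hf` intertwining, `hM` no eigenvectors — ★ T6∕T7 —, `hinj` injectivity), the
constant vector `e₀ ∈ Cᗮ ⊓ Kfix` with `f e₀ = 0`, `a e₀ ≠ 0`, ADMISSIBILITY `hadm` («`Π ⊓ Kfix` finite-dimensional for irreducible closed `Π ≤ Res`») and the DISCRETE CLOSURE letter `hdisc`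
(«`Res ⊓ Kfix ⊆ closure ⨆_{Π irreducible ≤ Res} (Π ⊓ Kfix)`»): **every `K`-fixed `v ∈ Res` lies in `ℂ ∙ e₀`** — each `Π ⊓ Kfix ≤ ℂ ∙ e₀` by §2, the `⨆` and its closure too (a line is
closed). [cite: MoeglinWaldspurger1995, V.3.13] [cite: Iwaniec2002, §7 (p. 103)] [cite: Borel1997, §§13–16] -/
theorem fixed_residual_mem_span_of_letters (hu : π.IsUnitary) (C Res : ClosedSubrep π) (hResC : ∀ v ∈ Res, v ∈ C.orthogonal hu)
    {S : Type*} [SetLike S G] (K : S)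
    (Kfix : Submodule ℂ V) (hKfix : ∀ v : V, v ∈ Kfix ↔ ∀ k ∈ K, π k v = v)
    {F : Type*} [AddCommGroup F] [Module ℂ F]
    (R₀ : V →ₗ[ℂ] V) (a : V →ₗ[ℂ] ℂ) (f : V →ₗ[ℂ] F) (M : F →ₗ[ℂ] F)
    (hRW : ∀ W : ClosedSubrep π, W ≤ Res → ∀ v ∈ W, R₀ v ∈ W)
    (hRK : ∀ v : V, (∀ k ∈ K, π k v = v) → ∀ k ∈ K, π k (R₀ v) = R₀ v)
    (hf : ∀ v ∈ C.orthogonal hu, (∀ k ∈ K, π k v = v) → f (R₀ v) = M (f v))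
    (hM : ∀ (c : ℂ) (w : F), M w = c • w → w = 0)
    (hinj : ∀ v ∈ C.orthogonal hu, (∀ k ∈ K, π k v = v) → a v = 0 → f v = 0 → v = 0)
    {e₀ : V} (he₀C : e₀ ∈ C.orthogonal hu) (he₀K : ∀ k ∈ K, π k e₀ = e₀) (hf₀ : f e₀ = 0) (ha₀ : a e₀ ≠ 0)
    (hadm : ∀ W : ClosedSubrep π, W ≤ Res → W.toContRep.IsTopIrreducible → FiniteDimensional ℂ ↥(W.toSubmodule ⊓ Kfix))
    (hdisc : ∀ v ∈ Res, (∀ k ∈ K, π k v = v) →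
      v ∈ (⨆ W ∈ {W : ClosedSubrep π | W ≤ Res ∧ W.toContRep.IsTopIrreducible}, W.toSubmodule ⊓ Kfix).topologicalClosure)
    {v : V} (hv : v ∈ Res) (hvK : ∀ k ∈ K, π k v = v) : v ∈ ℂ ∙ e₀ := by
  set E : Submodule ℂ V := (C.orthogonal hu).toSubmodule ⊓ Kfix with hE
  have hfE : ∀ w ∈ E, f (R₀ w) = M (f w) := fun w hw => hf w hw.1 ((hKfix w).1 hw.2)
  have hinjE : ∀ w ∈ E, a w = 0 → f w = 0 → w = 0 := fun w hw => hinj w hw.1 ((hKfix w).1 hw.2)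
  have he₀E : e₀ ∈ E := ⟨he₀C, (hKfix e₀).2 he₀K⟩
  -- each irreducible `W ≤ Res`: `W ⊓ Kfix ≤ ℂ ∙ e₀`
  have hW : ∀ W : ClosedSubrep π, W ≤ Res → W.toContRep.IsTopIrreducible → W.toSubmodule ⊓ Kfix ≤ ℂ ∙ e₀ := by
    intro W hWres hWirr
    haveI := hadm W hWres hWirr
    refine le_span_of_finiteDimensional_of_stable R₀ E a f M hfE hM hinjE he₀E hf₀ ha₀ (W.toSubmodule ⊓ Kfix) ?_ ?_
    · rintro w ⟨hwW, hwK⟩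
      exact ⟨hResC w (hWres hwW), hwK⟩
    · rintro w ⟨hwW, hwK⟩
      exact ⟨hRW W hWres w hwW, (hKfix _).2 (hRK w ((hKfix w).1 hwK))⟩
  have hsup : (⨆ W ∈ {W : ClosedSubrep π | W ≤ Res ∧ W.toContRep.IsTopIrreducible}, W.toSubmodule ⊓ Kfix) ≤ ℂ ∙ e₀ :=
    iSup₂_le fun W hWS => hW W hWS.1 hWS.2
  have hcl : (⨆ W ∈ {W : ClosedSubrep π | W ≤ Res ∧ W.toContRep.IsTopIrreducible}, W.toSubmodule ⊓ Kfix).topologicalClosure ≤ ℂ ∙ e₀ :=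
    Submodule.topologicalClosure_minimal _ hsup (Submodule.closed_of_finiteDimensional _)
  exact hcl (hdisc v hv hvK)

end Rep

/-! ## §4 `U(Φ₂)(L⁺)∖U(Φ₂)(𝔸_{L⁺})`: the `K`-FIXED RESIDUAL VECTORS ARE CONSTANT, ON THE LETTERS — the `≤` half of «`L²_res ⊓ sph = ℂ·𝟙`» in 5Res currency -/

section CM

variable (L : Type) [Field L] [NumberField L] [IsCMField L]
  (μ : Measure (UnitaryGroup.cmDatum L 2 (Matrix.of fun i j : Fin 2 => if i.val + j.val + 1 = 2 then (1 : L) else 0)).automorphicQuotient)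
  [(UnitaryGroup.cmDatum L 2 (Matrix.of fun i j : Fin 2 => if i.val + j.val + 1 = 2 then (1 : L) else 0)).IsAutomorphicMeasure μ]

/-- **R8₂-sph EXHAUSTION, SPHERICAL LINE, ON THE LETTERS (dealer (92) bytes)**: for the right regular representation of `U(Φ₂)(𝔸_{L⁺})` on `L²(U(Φ₂)(L⁺)∖U(Φ₂)(𝔸_{L⁺}), μ)`, ANY `K_U ≤ G(𝔸)`
(the maximal compact in the application) and the letters of §3 read at `D := L²_disc`, `C := L²_cusp` (so `residualPart = L²_res =` ★ `cmResidualSubspaceR L 2 μ`) with `e₀ := 𝟙 = Lp.const 2 μ 1`: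
**`∀ v ∈ (cmResidualSubspaceR L 2 μ).toSubmodule, (∀ k ∈ K_U, (rightRegular μ) k v = v) → v ∈ ℂ ∙ Lp.const 2 μ 1`**.  With ★ p859288 `span_const_le_cmResidualSubspace_two` this is
`L²_res ⊓ sph = ℂ·𝟙`, the R8 input of `sig_K2E1ResidualCompactU2` at the trivial `K`-type. [cite: MoeglinWaldspurger1995, V.3.13] [cite: Iwaniec2002, §7 (p. 103)] [cite: Rogawski1990, §13.5] -/
theorem residual_fixed_mem_span_const_cm_two_of_letters
    (K_U : Subgroup (UnitaryGroup.cmDatum L 2 (Matrix.of fun i j : Fin 2 => if i.val + j.val + 1 = 2 then (1 : L) else 0)).Adelic)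
    (Kfix : Submodule ℂ ((UnitaryGroup.cmDatum L 2 (Matrix.of fun i j : Fin 2 => if i.val + j.val + 1 = 2 then (1 : L) else 0)).L2 μ))
    (hKfix : ∀ v, v ∈ Kfix ↔ ∀ k ∈ K_U, (UnitaryGroup.cmDatum L 2 (Matrix.of fun i j : Fin 2 => if i.val + j.val + 1 = 2 then (1 : L) else 0)).rightRegular μ k v = v)
    {F : Type*} [AddCommGroup F] [Module ℂ F]
    (R₀ : (UnitaryGroup.cmDatum L 2 (Matrix.of fun i j : Fin 2 => if i.val + j.val + 1 = 2 then (1 : L) else 0)).L2 μ →ₗ[ℂ]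
      (UnitaryGroup.cmDatum L 2 (Matrix.of fun i j : Fin 2 => if i.val + j.val + 1 = 2 then (1 : L) else 0)).L2 μ)
    (a : (UnitaryGroup.cmDatum L 2 (Matrix.of fun i j : Fin 2 => if i.val + j.val + 1 = 2 then (1 : L) else 0)).L2 μ →ₗ[ℂ] ℂ)
    (f : (UnitaryGroup.cmDatum L 2 (Matrix.of fun i j : Fin 2 => if i.val + j.val + 1 = 2 then (1 : L) else 0)).L2 μ →ₗ[ℂ] F) (M : F →ₗ[ℂ] F)
    (hRW : ∀ W : ClosedSubrep ((UnitaryGroup.cmDatum L 2 (Matrix.of fun i j : Fin 2 => if i.val + j.val + 1 = 2 then (1 : L) else 0)).rightRegular μ),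
      W ≤ cmResidualSubspaceR L 2 μ → ∀ v ∈ W, R₀ v ∈ W)
    (hRK : ∀ v, (∀ k ∈ K_U, (UnitaryGroup.cmDatum L 2 (Matrix.of fun i j : Fin 2 => if i.val + j.val + 1 = 2 then (1 : L) else 0)).rightRegular μ k v = v) →
      ∀ k ∈ K_U, (UnitaryGroup.cmDatum L 2 (Matrix.of fun i j : Fin 2 => if i.val + j.val + 1 = 2 then (1 : L) else 0)).rightRegular μ k (R₀ v) = R₀ v)
    (hf : ∀ v ∈ (cmCuspidalSubspaceR L 2 μ).orthogonal ((UnitaryGroup.cmDatum L 2 (Matrix.of fun i j : Fin 2 => if i.val + j.val + 1 = 2 then (1 : L) else 0)).isUnitary_rightRegular μ),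
      (∀ k ∈ K_U, (UnitaryGroup.cmDatum L 2 (Matrix.of fun i j : Fin 2 => if i.val + j.val + 1 = 2 then (1 : L) else 0)).rightRegular μ k v = v) → f (R₀ v) = M (f v))
    (hM : ∀ (c : ℂ) (w : F), M w = c • w → w = 0)
    (hinj : ∀ v ∈ (cmCuspidalSubspaceR L 2 μ).orthogonal ((UnitaryGroup.cmDatum L 2 (Matrix.of fun i j : Fin 2 => if i.val + j.val + 1 = 2 then (1 : L) else 0)).isUnitary_rightRegular μ),
      (∀ k ∈ K_U, (UnitaryGroup.cmDatum L 2 (Matrix.of fun i j : Fin 2 => if i.val + j.val + 1 = 2 then (1 : L) else 0)).rightRegular μ k v = v) → a v = 0 → f v = 0 → v = 0)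
    (h1C : (Lp.const 2 μ (1 : ℂ) : (UnitaryGroup.cmDatum L 2 (Matrix.of fun i j : Fin 2 => if i.val + j.val + 1 = 2 then (1 : L) else 0)).L2 μ) ∈
      (cmCuspidalSubspaceR L 2 μ).orthogonal ((UnitaryGroup.cmDatum L 2 (Matrix.of fun i j : Fin 2 => if i.val + j.val + 1 = 2 then (1 : L) else 0)).isUnitary_rightRegular μ))
    (h1K : ∀ k ∈ K_U, (UnitaryGroup.cmDatum L 2 (Matrix.of fun i j : Fin 2 => if i.val + j.val + 1 = 2 then (1 : L) else 0)).rightRegular μ k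
      (Lp.const 2 μ (1 : ℂ) : (UnitaryGroup.cmDatum L 2 (Matrix.of fun i j : Fin 2 => if i.val + j.val + 1 = 2 then (1 : L) else 0)).L2 μ) = Lp.const 2 μ (1 : ℂ))
    (hf₁ : f (Lp.const 2 μ (1 : ℂ)) = 0) (ha₁ : a (Lp.const 2 μ (1 : ℂ)) ≠ 0)
    (hadm : ∀ W : ClosedSubrep ((UnitaryGroup.cmDatum L 2 (Matrix.of fun i j : Fin 2 => if i.val + j.val + 1 = 2 then (1 : L) else 0)).rightRegular μ),
      W ≤ cmResidualSubspaceR L 2 μ → W.toContRep.IsTopIrreducible → FiniteDimensional ℂ ↥(W.toSubmodule ⊓ Kfix))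
    (hdisc : ∀ v ∈ cmResidualSubspaceR L 2 μ, (∀ k ∈ K_U, (UnitaryGroup.cmDatum L 2 (Matrix.of fun i j : Fin 2 => if i.val + j.val + 1 = 2 then (1 : L) else 0)).rightRegular μ k v = v) →
      v ∈ (⨆ W ∈ {W : ClosedSubrep ((UnitaryGroup.cmDatum L 2 (Matrix.of fun i j : Fin 2 => if i.val + j.val + 1 = 2 then (1 : L) else 0)).rightRegular μ) |
        W ≤ cmResidualSubspaceR L 2 μ ∧ W.toContRep.IsTopIrreducible}, W.toSubmodule ⊓ Kfix).topologicalClosure) :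
    ∀ v ∈ (cmResidualSubspaceR L 2 μ).toSubmodule,
      (∀ k ∈ K_U, (UnitaryGroup.cmDatum L 2 (Matrix.of fun i j : Fin 2 => if i.val + j.val + 1 = 2 then (1 : L) else 0)).rightRegular μ k v = v) → v ∈ ℂ ∙ Lp.const 2 μ (1 : ℂ) :=
  fun _ hv hvK => fixed_residual_mem_span_of_letters (π := (UnitaryGroup.cmDatum L 2 (Matrix.of fun i j : Fin 2 => if i.val + j.val + 1 = 2 then (1 : L) else 0)).rightRegular μ)
    ((UnitaryGroup.cmDatum L 2 (Matrix.of fun i j : Fin 2 => if i.val + j.val + 1 = 2 then (1 : L) else 0)).isUnitary_rightRegular μ)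
    (cmCuspidalSubspaceR L 2 μ) (cmResidualSubspaceR L 2 μ)
    (fun _ hw => (show (cmResidualSubspaceR L 2 μ).toSubmodule ≤ (cmCuspidalSubspaceR L 2 μ).toSubmoduleᗮ from
      (isOrtho_cuspidalSubspace_residualSubspace _ μ (cmParabolicDataR L 2)).symm) hw)
    K_U Kfix hKfix R₀ a f M hRW hRK hf hM hinj h1C h1K hf₁ ha₁ hadm hdisc hv hvK

end CM

end Summit.HodgeConjecture.HodgeConjecture.Cruxes.H413.K2E1ResidualSphericalLineCMTwoOfLetters

end
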